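import Summits.QuantumFields.BalabanUV.Beta.GAN24.HardMinimiserOneStepSup

/-!
# `BalabanUV.Beta.GAN24.GalerkinPythagoras` — binder row G-an2-4 ∕ (CONV-C), route R7 «TWO CURRENCIES», the EXACT identity behind the
# (ρ3) GRADIENT LINE: for a Hermitian form `K` and its (soft ∕ constrained) minimiser `u`, `⟨f − u, K(f − u)⟩ = E[f] − E[u]` for every
# (admissible) trial field `f`; INSTANCES on the NE2 scalar carriers: the Dirichlet energy of `f − M v` (soft minimiser `M = a′G′Q′*`) and
# of `f − H v` (hard minimiser `H = M·S⁻¹`, `Q′f = v`) ARE energy defects — so the GRADIENT one-step defect of a minimiser leg against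
# ANY prolongation is a VALUE-level quantity

NOT IN PRINT; OUR PROOF ATTEMPT (prover part P3 of row G-an2-4, fibre∕strip («Woodbury») lineage, gen 25; CRUX TEAM (2), ruling «YM
REDIRECT TOWARDS THE SUMMIT», 2026-08-21: «work the best two candidate routes of record»).  HONEST DEPENDENCY (cell records, verbatim):
«continuum YM on T⁴ ⇐ BetaPertH ∧ nine spine estimates (0/9 proved); BetaPertH ⇐ (D1) ∧ (D4) ∧ CAP+tail; G-an2-4 gates asym, D1 and
NE2/3/4.»  HONEST FRAMING (cell contract, verbatim): «discharging `BetaPertH` makes Bałaban's UV stability UNCONDITIONAL — a real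
constructive-QFT result; it is NOT the continuum limit and NOT the Clay problem.»  ABSOLUTE RULE: nothing printed is a hypothesis; no
`def … : Prop`, no sorry; [folklore] finite-dimensional algebra over TREE objects BY NAME.

## What route R7 asks of this file (`HOME/beta/ROUTES-GAN24.md` v6 §2 R7 (iii) and S3 (ρ3); author gan24-idea-1, whose folder sketch
## `Sketch_R7.lean` e4a228c4b151a059 has `galerkin_pythagoras` ∕ `soft_pythagoras` ∕ `gradient_leg_sq_le` — re-proved here with credit, over `ℂ`)

(ρ3) needs the one-step rate of the GRADIENT of the unit-sourced minimiser legs.  R7 (iii) «CONVEX VALUES ⇒ ENERGY-NORM LEG RATE»: for a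
quadratic minimum problem the Pythagorean identity `E[f] − E[u] = ‖f − u‖²_K` holds for every trial `f` (soft functional: any `f`; hard
functional: admissible `f`), so `‖∇_η(𝓗_{k+1}B − ι𝓗_kB)‖² (+ a|Q(·)|²)` EQUALS the energy defect `E_{k+1}[ι𝓗_kB] − E_{k+1}[𝓗_{k+1}B]` — «the
gradient-leg rate needs exactly ONE new value-level estimate: the prolongation energy defect AT THE MINIMISER» (R1-S3♯'s object; the value
increments themselves are banked in the tree).  THIS FILE proves the identities:

 * §1 ABSTRACT (`K : Matrix ι ι ℂ` Hermitian): **`soft_pythagoras`** — if `K u = w` then for every `f`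
   `⟨f−u, K(f−u)⟩ = (⟨f,Kf⟩ − ⟨f,w⟩ − ⟨w,f⟩) − (⟨u,Ku⟩ − ⟨u,w⟩ − ⟨w,u⟩)`; **`hard_pythagoras`** — if `K u = Qᴴλ` (KKT) and `Q f = Q u`
   (admissibility) then `⟨f−u, K(f−u)⟩ = ⟨f,Kf⟩ − ⟨u,Ku⟩`; the minimum properties `re ⟨u,…⟩ ≤ re ⟨f,…⟩` when `K` is positive semidefinite.
 * §2 SOFT INSTANCE on the NE2 scalar carriers (`ScalarAveragedPropagator.DeltaPs = Δ + a′Π′`, `dirichlet`, `ScalarBlockPoincare.PiS`; p2's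
   `SoftMinimiserOneStepSup.Msoft = a′G′Q′*`, `blkInj = Q′*`): with `softE v f := re⟨f, Δ′f⟩ − 2a′·re⟨f, Q′*v⟩` (the soft functional
   `‖∂f‖² + a′‖Q′f − v‖²` in the tree's normalisation, up to the `f`-independent constant `a′n^d‖v‖²`), **`softE_sub_softE_Msoft`**:
   `softE v f − softE v (Mv) = dirichlet (f − Mv) + a′·nsq (Π′(f − Mv))` EXACTLY, for EVERY `f`; hence `dirichlet (f − Mv) ≤ softE v f − softE v (Mv)`
   (**`dirichlet_sub_Msoft_le`**) and `softE v (Mv) ≤ softE v f` (**`softE_Msoft_le`**).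
 * §3 HARD INSTANCE (p2's `HardMinimiserOneStepSup.Mhard = M·S⁻¹`, `Q′H = 1`): the KKT identity **`LapS_mulVec_Mhard`**
   `Δ(Hv) = Q′ᴴ·(a′n^d·(S⁻¹v − v))`, and **`dirichlet_sub_Mhard_eq`**: for every `f` with `Q′f = v`,
   `dirichlet (f − Hv) = dirichlet f − dirichlet (Hv)` EXACTLY (**`dirichlet_Mhard_le`**: `H v` minimises the Dirichlet energy on `{Q′f = v}`).
 * §4 THE (ρ3) READING, two levels (`N ↦ R·N`): for ANY field `g` on the finer lattice (a prolongation of the coarse leg — King's staircase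
   `stair N R M *ᵥ (M_N v)`, a multilinear `ι(M_N v)`, …) **`dirichlet_Msoft_succ_sub_le`**: `dirichlet (M_{RN} v − g) ≤ softE′ v g − softE′ v (M_{RN} v)`
   — the GRADIENT one-step defect of the soft leg is bounded by (indeed, with the `Π′` term, equal to) the prolongation energy defect; and the
   hard twin **`dirichlet_Mhard_succ_sub_eq`** for admissible `g` (`Q′_{RN} g = v`).

HONEST SCOPE.  Exact algebra; NO rate is proved here (the rate of the prolongation energy defect is R1-S3♯ ∕ road P2's, and the staircase is
the WRONG prolongation for the gradient line — its Dirichlet defect is `O(1)`, face-concentrated; a smooth `ι` is needed); scalar `U = 1`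
prototype carriers; NOT (CONV-C), NOT (ρ3) itself, NEVER «G-an2-4 closed», NOT D1, NOT BetaPertH, NOT continuum, NOT Clay.  Locators (text
only): [Balaban1984PropagatorsI] (1.73) p. 30, (1.103) p. 34; [King1986] (4.2) p. 670.  Provenance: prover-b2b-balaban-gan24-p3-g25-0 (unit
`b2b-balaban-gan24-p3`, gen 25), 2026-08-21.
-/

noncomputable section

open scoped BigOperators ComplexConjugate ComplexOrder Matrix

namespace Summit.QuantumFields.BalabanUV.Beta.GAN24.GalerkinPythagoras

open Literature.MathematicalPhysics.QuantumFieldTheory.Balaban1983to89.B5Prop11Plancherel (Tor fine)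
open Literature.MathematicalPhysics.QuantumFieldTheory.Balaban1983to89.B5Prop11Lower (nsq nsq_nonneg star_dotProduct_self)
open Literature.MathematicalPhysics.QuantumFieldTheory.Balaban1983to89.B5Action121 (sdiff LapS)
open Literature.MathematicalPhysics.QuantumFieldTheory.Balaban1983to89.B5Block118 (QsOp)
open Summit.QuantumFields.BalabanUV.T4Continuum.ScalarBlockPoincare (PiS form_LapS_eq form_PiS)
open Summit.QuantumFields.BalabanUV.T4Continuum.ScalarAveragedPropagator (DeltaPs Gps dirichlet dirichlet_nonneg DeltaPs_isHermitian
  LapS_isHermitian' form_DeltaPs re_form_DeltaPs)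
open Summit.QuantumFields.BalabanUV.Beta.GAN24.StaircaseLaplacianDefect (stair)
open Summit.QuantumFields.BalabanUV.Beta.GAN24.SoftMinimiserOneStepSup (blkInj Msoft DeltaPs_mulVec_Msoft blkInj_mulVec)
open Summit.QuantumFields.BalabanUV.Beta.GAN24.HardMinimiserOneStepSup (Savg Mhard isUnit_det_Savg QsOp_mul_Mhard Mhard_mulVec
  blkInj_eq_smul)

/-! ## §1 The abstract identities -/

section Abstract

variable {ι κ : Type*} [Fintype ι] [Fintype κ]

/-- Hermitian adjointness on vectors: `⟨u, Kf⟩ = ⟨Ku, f⟩` (`Kᴴ = K`). [folklore] -/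
theorem star_dotProduct_mulVec_of_isHermitian {K : Matrix ι ι ℂ} (hK : K.IsHermitian) (u f : ι → ℂ) :
    star u ⬝ᵥ (K *ᵥ f) = star (K *ᵥ u) ⬝ᵥ f := by
  rw [Matrix.star_mulVec, hK.eq, Matrix.dotProduct_mulVec]

/-- **SOFT PYTHAGORAS (exact)**: `K` Hermitian, `K u = w` ⟹ for every `f`,
`⟨f−u, K(f−u)⟩ = (⟨f,Kf⟩ − ⟨f,w⟩ − ⟨w,f⟩) − (⟨u,Ku⟩ − ⟨u,w⟩ − ⟨w,u⟩)` — the quadratic functional with source `w` exceeds its value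
at the critical point by exactly the `K`-energy of the difference. [folklore] -/
theorem soft_pythagoras {K : Matrix ι ι ℂ} (hK : K.IsHermitian) {u w : ι → ℂ} (hu : K *ᵥ u = w) (f : ι → ℂ) :
    star (f - u) ⬝ᵥ (K *ᵥ (f - u))
      = (star f ⬝ᵥ (K *ᵥ f) - star f ⬝ᵥ w - star w ⬝ᵥ f) - (star u ⬝ᵥ (K *ᵥ u) - star u ⬝ᵥ w - star w ⬝ᵥ u) := by
  have h1 : star u ⬝ᵥ (K *ᵥ f) = star w ⬝ᵥ f := by rw [star_dotProduct_mulVec_of_isHermitian hK, hu]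
  have h2 : star f ⬝ᵥ (K *ᵥ u) = star f ⬝ᵥ w := by rw [hu]
  have h3 : star u ⬝ᵥ (K *ᵥ u) = star u ⬝ᵥ w := by rw [hu]
  have h4 : star w ⬝ᵥ u = star u ⬝ᵥ w := by
    rw [← h3, star_dotProduct_mulVec_of_isHermitian hK, hu]
  rw [star_sub, sub_dotProduct, Matrix.mulVec_sub, dotProduct_sub, dotProduct_sub, h1, h2, h3, h4]
  ring

/-- **HARD PYTHAGORAS (exact)**: `K` Hermitian, KKT `K u = Qᴴλ`, admissibility `Q f = Q u` ⟹ `⟨f−u, K(f−u)⟩ = ⟨f,Kf⟩ − ⟨u,Ku⟩` — the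
constrained quadratic minimum is exceeded by exactly the `K`-energy of the difference. [folklore] -/
theorem hard_pythagoras {K : Matrix ι ι ℂ} (hK : K.IsHermitian) (Q : Matrix κ ι ℂ) {u : ι → ℂ} {lam : κ → ℂ}
    (hKKT : K *ᵥ u = Qᴴ *ᵥ lam) {f : ι → ℂ} (hadm : Q *ᵥ f = Q *ᵥ u) :
    star (f - u) ⬝ᵥ (K *ᵥ (f - u)) = star f ⬝ᵥ (K *ᵥ f) - star u ⬝ᵥ (K *ᵥ u) := by
  -- the two cross terms both equal `⟨u, Ku⟩`
  have hQ : ∀ g : ι → ℂ, star g ⬝ᵥ (Qᴴ *ᵥ lam) = star (Q *ᵥ g) ⬝ᵥ lam := fun g => by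
    rw [Matrix.star_mulVec, Matrix.dotProduct_mulVec]
  have h2 : star f ⬝ᵥ (K *ᵥ u) = star u ⬝ᵥ (K *ᵥ u) := by rw [hKKT, hQ, hQ, hadm]
  have h1 : star u ⬝ᵥ (K *ᵥ f) = star u ⬝ᵥ (K *ᵥ u) := by
    rw [star_dotProduct_mulVec_of_isHermitian hK u f, star_dotProduct_mulVec_of_isHermitian hK u u, hKKT,
      Matrix.star_mulVec, Matrix.conjTranspose_conjTranspose, ← Matrix.dotProduct_mulVec, ← Matrix.dotProduct_mulVec, hadm]
  rw [star_sub, sub_dotProduct, Matrix.mulVec_sub, dotProduct_sub, dotProduct_sub, h1, h2]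
  ring

/-- the soft minimum property: `K` positive semidefinite, `K u = w` ⟹ `re E[u] ≤ re E[f]` with `E[f] = ⟨f,Kf⟩ − ⟨f,w⟩ − ⟨w,f⟩`. [folklore] -/
theorem soft_min_le {K : Matrix ι ι ℂ} (hK : K.PosSemidef) {u w : ι → ℂ} (hu : K *ᵥ u = w) (f : ι → ℂ) :
    (star u ⬝ᵥ (K *ᵥ u) - star u ⬝ᵥ w - star w ⬝ᵥ u).re ≤ (star f ⬝ᵥ (K *ᵥ f) - star f ⬝ᵥ w - star w ⬝ᵥ f).re := by
  have h := soft_pythagoras hK.isHermitian hu f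
  have hnn : 0 ≤ (star (f - u) ⬝ᵥ (K *ᵥ (f - u))).re := (Complex.nonneg_iff.mp (hK.dotProduct_mulVec_nonneg (f - u))).1
  rw [h, Complex.sub_re] at hnn
  linarith

/-- the hard minimum property: `K` positive semidefinite, KKT + admissibility ⟹ `re ⟨u,Ku⟩ ≤ re ⟨f,Kf⟩`. [folklore] -/
theorem hard_min_le {K : Matrix ι ι ℂ} (hK : K.PosSemidef) (Q : Matrix κ ι ℂ) {u : ι → ℂ} {lam : κ → ℂ}
    (hKKT : K *ᵥ u = Qᴴ *ᵥ lam) {f : ι → ℂ} (hadm : Q *ᵥ f = Q *ᵥ u) :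
    (star u ⬝ᵥ (K *ᵥ u)).re ≤ (star f ⬝ᵥ (K *ᵥ f)).re := by
  have h := hard_pythagoras hK.isHermitian Q hKKT hadm
  have hnn : 0 ≤ (star (f - u) ⬝ᵥ (K *ᵥ (f - u))).re := (Complex.nonneg_iff.mp (hK.dotProduct_mulVec_nonneg (f - u))).1
  rw [h, Complex.sub_re] at hnn
  linarith

end Abstract

/-! ## §2 The soft instance on the NE2 scalar carriers -/

section Soft

variable {d : ℕ} (n : ℕ) [NeZero n] (M : Fin d → ℕ) [hM : ∀ μ, NeZero (M μ)] (a' : ℝ)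

/-- **THE SOFT FUNCTIONAL** in the tree's normalisation: `softE v f = re⟨f, Δ′f⟩ − 2a′·re⟨f, Q′*v⟩` — equal to `‖∂f‖² + a′·n^d‖Q′f − v‖²`
up to the `f`-independent constant `a′n^d‖v‖²` (King's `½‖∂u‖² + (a′/2)‖Q′u − v‖²` doubled, [B5] (1.68)/(1.73) at `U = 1`). [folklore] -/
def softE (v : Tor M → ℂ) (f : Tor (fine n M) → ℂ) : ℝ :=
  (star f ⬝ᵥ (DeltaPs n M a' *ᵥ f)).re - 2 * a' * (star f ⬝ᵥ (blkInj n M *ᵥ v)).re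

/-- `re⟨w, f⟩ = re⟨f, w⟩`. [folklore] -/
theorem re_star_dotProduct_comm {ι : Type*} [Fintype ι] (f w : ι → ℂ) : (star w ⬝ᵥ f).re = (star f ⬝ᵥ w).re := by
  rw [Matrix.star_dotProduct w f, Complex.star_def, Complex.conj_re]

/-- **SOFT PYTHAGORAS ON THE NE2 CARRIERS (exact)**: for EVERY trial field `f`,
`softE v f − softE v (M v) = dirichlet (f − Mv) + a′·nsq (Π′(f − Mv))` (`M = Msoft = a′G′Q′*`, `Δ′(Mv) = a′Q′*v`). [folklore] -/
theorem softE_sub_softE_Msoft (ha' : 0 < a') (v : Tor M → ℂ) (f : Tor (fine n M) → ℂ) :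
    softE n M a' v f - softE n M a' v (Msoft n M a' *ᵥ v)
      = dirichlet n M (f - Msoft n M a' *ᵥ v) + a' * nsq (PiS n M *ᵥ (f - Msoft n M a' *ᵥ v)) := by
  have hu := DeltaPs_mulVec_Msoft n M ha' v
  have h := soft_pythagoras (DeltaPs_isHermitian n M a') hu f
  have hre := congrArg Complex.re h
  rw [re_form_DeltaPs] at hre
  set w : Tor (fine n M) → ℂ := (a' : ℂ) • (blkInj n M *ᵥ v) with hw
  have k1 : ∀ g : Tor (fine n M) → ℂ, (star g ⬝ᵥ w).re = a' * (star g ⬝ᵥ (blkInj n M *ᵥ v)).re := fun g => by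
    rw [hw, dotProduct_smul, smul_eq_mul, Complex.re_ofReal_mul]
  have k2 : ∀ g : Tor (fine n M) → ℂ, (star w ⬝ᵥ g).re = a' * (star g ⬝ᵥ (blkInj n M *ᵥ v)).re := fun g => by
    rw [re_star_dotProduct_comm g w, k1]
  rw [hre]
  simp only [softE, Complex.sub_re, k1, k2]
  ring

/-- **the GRADIENT defect of the soft leg against ANY trial field is at most the energy defect**:
`dirichlet (f − Mv) ≤ softE v f − softE v (Mv)`. [folklore] -/
theorem dirichlet_sub_Msoft_le (ha' : 0 < a') (v : Tor M → ℂ) (f : Tor (fine n M) → ℂ) :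
    dirichlet n M (f - Msoft n M a' *ᵥ v) ≤ softE n M a' v f - softE n M a' v (Msoft n M a' *ᵥ v) := by
  rw [softE_sub_softE_Msoft n M a' ha']
  have := nsq_nonneg (PiS n M *ᵥ (f - Msoft n M a' *ᵥ v))
  nlinarith

/-- **`M v` minimises the soft functional**: `softE v (Mv) ≤ softE v f` for every `f`. [folklore] -/
theorem softE_Msoft_le (ha' : 0 < a') (v : Tor M → ℂ) (f : Tor (fine n M) → ℂ) :
    softE n M a' v (Msoft n M a' *ᵥ v) ≤ softE n M a' v f := by
  have h1 := dirichlet_sub_Msoft_le n M a' ha' v f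
  have h2 := dirichlet_nonneg n M (f - Msoft n M a' *ᵥ v)
  linarith

end Soft

/-! ## §3 The hard instance: `H v = M(S⁻¹v)` minimises the Dirichlet energy on `{Q′f = v}` -/

section Hard

variable {d : ℕ} (n : ℕ) [NeZero n] (M : Fin d → ℕ) [hM : ∀ μ, NeZero (M μ)] (a' : ℝ)

/-- `Π′ = Q′ᴴ·(n^d·Q′)`-type factorisation applied to a field with prescribed block means: `Q′f = v ⟹ Π′f = Q′*v` (`Q′* = blkInj`). [folklore] -/
theorem PiS_mulVec_of_QsOp (f : Tor (fine n M) → ℂ) (v : Tor M → ℂ) (hf : QsOp n M *ᵥ f = v) :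
    PiS n M *ᵥ f = blkInj n M *ᵥ v := by
  rw [PiS, Matrix.smul_mulVec, ← Matrix.mulVec_mulVec, hf, blkInj_eq_smul, Matrix.smul_mulVec]

/-- **THE KKT IDENTITY OF THE HARD MINIMISER**: `Δ(Hv) = Q′ᴴ·λ` with `λ = a′n^d·(S⁻¹v − v)` (from `Δ′(M w) = a′Q′*w`, `w = S⁻¹v`,
`Q′H = 1`, `Δ′ = Δ + a′Π′`, `Q′* = n^dQ′ᴴ`). [folklore] -/
theorem LapS_mulVec_Mhard (ha' : 0 < a') (v : Tor M → ℂ) :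
    LapS (fine n M) (n : ℂ) *ᵥ (Mhard n M a' *ᵥ v)
      = (QsOp n M)ᴴ *ᵥ (((a' : ℂ) * (n : ℂ) ^ d) • ((Savg n M a')⁻¹ *ᵥ v - v)) := by
  have hQH : QsOp n M *ᵥ (Mhard n M a' *ᵥ v) = v := by
    rw [Matrix.mulVec_mulVec, QsOp_mul_Mhard n M ha', Matrix.one_mulVec]
  have hD : DeltaPs n M a' *ᵥ (Mhard n M a' *ᵥ v) = (a' : ℂ) • (blkInj n M *ᵥ ((Savg n M a')⁻¹ *ᵥ v)) := by
    rw [Mhard_mulVec, DeltaPs_mulVec_Msoft n M ha']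
  have hPi : PiS n M *ᵥ (Mhard n M a' *ᵥ v) = blkInj n M *ᵥ v := PiS_mulVec_of_QsOp n M _ v hQH
  have hsplit : LapS (fine n M) (n : ℂ) *ᵥ (Mhard n M a' *ᵥ v)
      = DeltaPs n M a' *ᵥ (Mhard n M a' *ᵥ v) - (a' : ℂ) • (PiS n M *ᵥ (Mhard n M a' *ᵥ v)) := by
    rw [DeltaPs, Matrix.add_mulVec, Matrix.smul_mulVec]; abel
  rw [hsplit, hD, hPi, blkInj_eq_smul, Matrix.smul_mulVec, Matrix.smul_mulVec, ← smul_sub, ← smul_sub, smul_smul,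
    ← Matrix.mulVec_sub, ← Matrix.mulVec_smul]

/-- **HARD PYTHAGORAS ON THE NE2 CARRIERS (exact)**: for every ADMISSIBLE trial field (`Q′f = v`),
`dirichlet (f − Hv) = dirichlet f − dirichlet (Hv)`. [folklore] -/
theorem dirichlet_sub_Mhard_eq (ha' : 0 < a') (v : Tor M → ℂ) (f : Tor (fine n M) → ℂ) (hf : QsOp n M *ᵥ f = v) :
    dirichlet n M (f - Mhard n M a' *ᵥ v) = dirichlet n M f - dirichlet n M (Mhard n M a' *ᵥ v) := by
  have hQH : QsOp n M *ᵥ (Mhard n M a' *ᵥ v) = v := by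
    rw [Matrix.mulVec_mulVec, QsOp_mul_Mhard n M ha', Matrix.one_mulVec]
  have hadm : QsOp n M *ᵥ f = QsOp n M *ᵥ (Mhard n M a' *ᵥ v) := by rw [hf, hQH]
  have hL : (LapS (fine n M) (n : ℂ)).IsHermitian := LapS_isHermitian' n M
  have h := hard_pythagoras hL (QsOp n M) (LapS_mulVec_Mhard n M a' ha' v) hadm
  have e : ∀ g : Tor (fine n M) → ℂ, star g ⬝ᵥ (LapS (fine n M) (n : ℂ) *ᵥ g) = ((dirichlet n M g : ℝ) : ℂ) := fun g => by
    rw [form_LapS_eq]; rfl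
  rw [e, e, e, ← Complex.ofReal_sub] at h
  exact_mod_cast h

/-- **`H v` minimises the Dirichlet energy among fields with block means `v`**. [folklore] -/
theorem dirichlet_Mhard_le (ha' : 0 < a') (v : Tor M → ℂ) (f : Tor (fine n M) → ℂ) (hf : QsOp n M *ᵥ f = v) :
    dirichlet n M (Mhard n M a' *ᵥ v) ≤ dirichlet n M f := by
  have h := dirichlet_sub_Mhard_eq n M a' ha' v f hf
  have := dirichlet_nonneg n M (f - Mhard n M a' *ᵥ v)
  linarith

end Hard

/-! ## §4 The (ρ3) reading across two levels: the GRADIENT one-step defect of a minimiser leg against ANY prolongation is an energy defect -/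

section TwoLevel

variable {d : ℕ} (N R : ℕ) [NeZero N] [NeZero R] (M : Fin d → ℕ) [hM : ∀ μ, NeZero (M μ)] (a' : ℝ)

/-- **SOFT LEG, two levels**: for ANY field `g` on the finer lattice (a prolongation of the coarse leg `M_N v` — the staircase
`stair N R M *ᵥ (M_N v)`, a multilinear `ι(M_N v)`, …), `dirichlet (M_{RN}v − g) ≤ softE′ v g − softE′ v (M_{RN} v)`: the gradient
one-step defect is bounded by (with the `Π′` term: equal to) the PROLONGATION ENERGY DEFECT at the finer level. [folklore] -/
theorem dirichlet_Msoft_succ_sub_le (ha' : 0 < a') (v : Tor M → ℂ) (g : Tor (fine (R * N) M) → ℂ) :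
    dirichlet (R * N) M (Msoft (R * N) M a' *ᵥ v - g)
      ≤ softE (R * N) M a' v g - softE (R * N) M a' v (Msoft (R * N) M a' *ᵥ v) := by
  have h := dirichlet_sub_Msoft_le (R * N) M a' ha' v g
  have e : dirichlet (R * N) M (Msoft (R * N) M a' *ᵥ v - g) = dirichlet (R * N) M (g - Msoft (R * N) M a' *ᵥ v) := by
    rw [← neg_sub, dirichlet, dirichlet]
    refine Finset.sum_congr rfl fun ν _ => ?_
    rw [Matrix.mulVec_neg, nsq, nsq]
    exact Finset.sum_congr rfl fun x _ => by rw [Pi.neg_apply, norm_neg]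
  rw [e]; exact h

/-- the same with the prolongation taken to be KING's STAIRCASE of the coarse soft leg (the comparison field of road P2's sup law;
for the gradient line a smooth prolongation is the better trial field — the bound holds for both). [folklore] -/
theorem dirichlet_Msoft_succ_sub_stair_le (ha' : 0 < a') (v : Tor M → ℂ) :
    dirichlet (R * N) M (Msoft (R * N) M a' *ᵥ v - stair N R M *ᵥ (Msoft N M a' *ᵥ v))
      ≤ softE (R * N) M a' v (stair N R M *ᵥ (Msoft N M a' *ᵥ v)) - softE (R * N) M a' v (Msoft (R * N) M a' *ᵥ v) :=
  dirichlet_Msoft_succ_sub_le N R M a' ha' v _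

/-- **HARD LEG, two levels**: for every ADMISSIBLE field `g` on the finer lattice (`Q′_{RN} g = v`, e.g. a block-mean-corrected prolongation
of `H_N v`), `dirichlet (H_{RN}v − g) = dirichlet g − dirichlet (H_{RN} v)` EXACTLY. [folklore] -/
theorem dirichlet_Mhard_succ_sub_eq (ha' : 0 < a') (v : Tor M → ℂ) (g : Tor (fine (R * N) M) → ℂ) (hg : QsOp (R * N) M *ᵥ g = v) :
    dirichlet (R * N) M (Mhard (R * N) M a' *ᵥ v - g) = dirichlet (R * N) M g - dirichlet (R * N) M (Mhard (R * N) M a' *ᵥ v) := by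
  have h := dirichlet_sub_Mhard_eq (R * N) M a' ha' v g hg
  have e : dirichlet (R * N) M (Mhard (R * N) M a' *ᵥ v - g) = dirichlet (R * N) M (g - Mhard (R * N) M a' *ᵥ v) := by
    rw [← neg_sub, dirichlet, dirichlet]
    refine Finset.sum_congr rfl fun ν _ => ?_
    rw [Matrix.mulVec_neg, nsq, nsq]
    exact Finset.sum_congr rfl fun x _ => by rw [Pi.neg_apply, norm_neg]
  rw [e, h]

end TwoLevel

end Summit.QuantumFields.BalabanUV.Beta.GAN24.GalerkinPythagoras

end
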